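import Summits.BirchSwinnertonDyer.Rank1Residual.GaloisImage.KolyvaginLevelOneUnitCaseOfDictionary
import Summits.BirchSwinnertonDyer.Rank1Residual.GaloisImage.PropagatedConditionCard
import Summits.BirchSwinnertonDyer.Rank1Residual.GaloisImage.PropagatedStructureCoreRank
import Literature.NumberTheory.GaloisRepresentations.ContinuousH1OrderTwo
import HarnessLib

/-!
# The EXOTIC `t ≥ 1` corner, made precise: at `E(ℚ₃)[3] ≠ 0` the level-one dictionary's bottom class
# IS a `3`-Selmer class — the level-one certificate is refuted by DICT3₁ itself
# (cell `b2b-bsdres`, team n1011, row T-a5x-II (II.4); seat p13)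

HONEST FRAMING (cell `b2b-bsdres`, run/shared/lean/b2b/bsd-rank1-residual/, verbatim in every
file): the goal of the cell is to DELETE the COMBINATION-SHAPED residual classes of the
Birch–Swinnerton-Dyer formula for ALL analytic-rank `≤ 1` elliptic curves over `ℚ` — "full BSD
formula for every rank `≤ 1` curve in class `C`" assembled STRICTLY from published theorems — so
that the rank-`≤ 1` remainder becomes exactly the CONSTRUCTION-SHAPED classes, which are TYPED
(missing-input `Prop`s), NOT attempted. This is not "finishing BSD". Team n1011 (N10/N11, the
additive block `X4 ∧ p = 3`): research route; no claim beyond the stated classes; the label X4 and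
the mark of RESIDUAL-MAP §I N11 are UNCHANGED by this file; nothing is booked. Theorems only: a
NEGATIVE / structural statement about the level-one method, not about BSD.

## What and why

T-a5x closed the EXOTIC unit case at `t = 0` (`#E(ℚ₃)[3] = 3^t = 1`) from the level-one dictionary
DICT3₁ (p271070 / p266233): the VALUE CLAUSE `Λ(loc_{v₃} κ_∅) = u·3^t·δ̃` with `t = 0` and `δ̃ = [0]⁺`
a `3`-adic unit makes the bottom class `κ'_∅` of Kato's Kolyvagin system a NON-Selmer class — the
level-one certificate.  The cell text names "EXOTIC ∧ `t = 1`" (two curves on `N < 5·10⁵`: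
388800ha1, 388800ij1, n1011-p14 e11 §7) as the residual corner.  This file proves WHY it is a corner
OF THE METHOD and not of the bookkeeping: for `t ≥ 1` the factor `3^t` vanishes in `ℤ/3`, so
`Λ(loc_{v₃} κ_∅) = 0`, so `loc_{v₃} κ'_∅ ∈ 𝒦_{v₃}` (kernel clause); and at every other place
`𝓕_can = 𝒦` (finite `v ∤ 3`: n1011-p04's (Lp) equality `propagatedSelmerStructureOne_inr_eq_kummer_…`
from `hEP`; infinite place: `H¹(ℝ, E[3]) = 0`, odd torsion) — hence **`κ'_∅ ∈ Sel^(3)(E/ℚ)`**: the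
bottom class IS a `3`-Selmer class and the certificate hypothesis `κ'_∅ ∉ Sel₃` of p265535 is
REFUTED by the dictionary data themselves.  No level-one argument of this shape can reach `t ≥ 1`
rows (levels `≥ 2` are void on EXOTIC rows by p267959 / II.1): the corner is intrinsic.

* `mem_selmerGroup_kummer_of_mem_propagated_of_localization_mem` — `x ∈ H¹_{𝓕_can}(ℚ, E[3])` with
  `loc_{v₃} x ∈ 𝒦_{v₃}` lies in `Sel^(3) = H¹_𝒦` (from `hEP`; any `E/ℚ`).
* `apply_empty_mem_selmerGroup_kummer_of_apply_eq_zero` — the Kato-type clauses of p266233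
  (`κ₀`, `κ'`, (I4), `Λ` with the kernel clause) with `Λ(loc_{v₃} κ₀ ∅) = 0` give `κ'_∅ ∈ Sel^(3)(E/ℚ)`;
  **`apply_empty_mem_selmerGroup_kummer_of_dictionary_of_pos`** (value clause `u·3^t·δ`, `1 ≤ t` —
  for EVERY `δ`) and `…_of_delta_eq_zero` (`δ = 0`: `3 ∣ [0]⁺`, every `t`) are the two readings.
* **`exists_kolyvaginSystem_apply_empty_mem_selmerGroup_of_dictionaryOne_of_pos`** /
  `…_of_ratModP_eq_zero` — DICT3₁-currency: on an additive `3 ∤ c₃`, surj(3) row with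
  `#E(ℚ₃)[3] = 3^t`, the PORT `KatoKuriharaDictionaryThreeOneAt W t D v₃` with `t ≥ 1`, resp. with
  `[0]⁺ ≡ 0 (mod 3)`, yields a Kolyvagin system `κ' ∈ KS₁(E[3], 𝓕̄_can, 𝒫)` whose bottom class IS a
  `3`-Selmer class.  EXOTIC r0 census (`N < 5·10⁵`, p13 T-a5 / p14 e11 §7): 16 unit rows (II.2 /
  II.5 apply), 2 rows with `t = 1` (388800ha1, 388800ij1: IV*, `c₃ = 3`), 2 rows with `3 ∣ c_ℓ`,
  `ℓ ≠ 3` (388800ho1, 388800ii1: `[0]⁺ ≡ 0`) — the four-curve corner of the level-one method.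

Nothing booked; no mark / label changed; EXOTIC rows REDUCED (t = 0) / CORNERED (t ≥ 1), none closed.

References: C.-H. Kim, AJM 148 (2026) Thm. 3.13, §3.4.1 (the factor `#E(ℚ_p)[p]`)
[Kim2022StructureSelmer]; J. S. Milne, *ADT* I Lemma 3.3 [MilneADT2006]; J.-P. Serre, *Cohomologie
galoisienne* I §2.4 [SerreGaloisCohomology1997].
-/

noncomputable section

open scoped Classical NumberField ContRepresentation
open Field NumberField IsDedekindDomain
open WeierstrassCurve Literature.NumberTheory.EllipticCurves Literature.NumberTheory.EllipticCurves.ModularForms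
  Literature.NumberTheory.EllipticCurves.Rank1Residual
  Literature.NumberTheory.GaloisRepresentations
  Literature.NumberTheory.GaloisRepresentations.DiscreteGaloisModule Literature.NumberTheory.GaloisCohomology
open Literature.NumberTheory.DiophantineGeometry.Dioph (ratModP)

namespace Summit.BirchSwinnertonDyer.Rank1Residual.GaloisImage

variable (W : WeierstrassCurve ℚ) [W.IsElliptic]

/-- **`H¹_{𝓕_can}(ℚ, E[3])` meets `Sel^(3)` in everything whose localisation above `3` is a Kummer
class.**  For `x ∈ H¹_{𝓕_can}(ℚ, E[3])` with `loc_{v₃} x ∈ 𝒦_{v₃}`: at finite `v ∤ 3`,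
`𝓕_can(v) = 𝒦(v)` (n1011-p04's `propagatedSelmerStructureOne_inr_eq_kummer_of_not_mem_of_localEuler`,
from `hEP`); above `3` the place is `v₃` (p13's `heightOneSpectrum_eq_of_three_mem`, p256641); at
the infinite place `H¹(ℝ, E[3]) = 0` (`3` odd).  So `x ∈ H¹_𝒦 = Sel^(3)(E/ℚ)`. [cite: MilneADT2006, Ch. I, Lemma 3.3]
[cite: SerreGaloisCohomology1997, I.§2.4] -/
theorem mem_selmerGroup_kummer_of_mem_propagated_of_localization_mem
    (hEP : ∀ v : HeightOneSpectrum (𝓞 ℚ), localEulerPoincareCharacteristic (v.adicCompletion ℚ))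
    {x : galoisCohomology (W.torsionGaloisModule ((3 : ℕ) : ℤ)) 1}
    (hx : x ∈ (propagatedSelmerStructureOne W 3).selmerGroup)
    (v₃ : HeightOneSpectrum (𝓞 ℚ)) (hv₃ : ((3 : ℕ) : 𝓞 ℚ) ∈ v₃.asIdeal)
    (hx₃ : galoisCohomology.localization _ (Sum.inr v₃) 1 x ∈
      W.kummerSelmerStructure ((3 : ℕ) : ℤ) (Sum.inr v₃)) :
    x ∈ (W.kummerSelmerStructure ((3 : ℕ) : ℤ)).selmerGroup := by
  haveI : Fact (Nat.Prime 3) := ⟨Nat.prime_three⟩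
  rw [SelmerStructure.mem_selmerGroup_iff]
  rw [SelmerStructure.mem_selmerGroup_iff] at hx
  rintro (w | v)
  · -- infinite place: the local class vanishes (`3` is odd)
    have h0 : galoisCohomology.localization _ (Sum.inl w) 1 x = 0 := by
      refine eq_zero_of_odd_nsmul_galoisCohomology_one_toLocal_inl _ w (n := 3) (by decide) _ ?_
      rw [← map_nsmul, galoisCohomology.nsmul_eq_zero_of_forall _ (fun P => ?_) x, map_zero]
      apply Subtype.ext
      rw [AddSubmonoidClass.coe_nsmul, ZeroMemClass.coe_zero, ← natCast_zsmul]
      exact (Submodule.mem_torsionBy_iff _ _).mp P.2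
    rw [h0]
    exact zero_mem _
  · by_cases hv : ((3 : ℕ) : 𝓞 ℚ) ∈ v.asIdeal
    · rw [heightOneSpectrum_eq_of_three_mem hv hv₃]
      exact hx₃
    · rw [← propagatedSelmerStructureOne_inr_eq_kummer_of_not_mem_of_localEuler W 3 v (hEP v) hv]
      exact hx (Sum.inr v)

/-- **A vanishing value clause makes the bottom class a `3`-Selmer class.**  Same clauses as
p266233 `apply_empty_not_mem_selmerGroup_kummer_of_dictionary` — a family `κ₀`, a Kolyvagin system
`κ' ∈ KS₁(E[3], 𝓕̄_can, 𝒫)` congruent to it (I4), `Λ : H¹(ℚ_{v₃}, E[3]) → ℤ/3` with the KERNEL CLAUSE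
(`Λ = 0 ↔ Kummer` on `𝓕̄_can(v₃)`) — and `Λ(loc_{v₃} κ₀ ∅) = 0`: then `loc_{v₃} κ'_∅ = loc_{v₃} κ₀ ∅ ∈ 𝒦_{v₃}`
and `κ'_∅ ∈ Sel^(3)(E/ℚ)` by the previous theorem.  The two ways the dictionary's value
`u·3^t·δ̃` vanishes in `ℤ/3` are read off below: `t ≥ 1` (`E(ℚ₃)[3] ≠ 0`) and `δ̃ = [0]⁺ ≡ 0`
(`3 ∣ L(E,1)/Ω⁺_f`, e.g. a Tamagawa number divisible by `3` away from `3`).  Nothing booked.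
[cite: Kim2022StructureSelmer, Thm. 3.13 and §3.4.1] -/
theorem apply_empty_mem_selmerGroup_kummer_of_apply_eq_zero
    (hEP : ∀ v : HeightOneSpectrum (𝓞 ℚ), localEulerPoincareCharacteristic (v.adicCompletion ℚ))
    {D : KolyvaginDatum (W.torsionGaloisModule ((3 : ℕ) : ℤ))}
    (v₃ : HeightOneSpectrum (𝓞 ℚ)) (hv₃ : ((3 : ℕ) : 𝓞 ℚ) ∈ v₃.asIdeal)
    (κ₀ : Finset (HeightOneSpectrum (𝓞 ℚ)) → galoisCohomology (W.torsionGaloisModule ((3 : ℕ) : ℤ)) 1)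
    (κ' : D.kolyvaginSystems (propagatedSelmerStructureOne W 3))
    (hI4 : ∀ d, D.IsLevel d →
      κ'.1 d - κ₀ d ∈ AddSubgroup.closure {x | ∃ c, c ⊂ d ∧ x = κ₀ c})
    (Λ : galoisCohomology ((W.torsionGaloisModule ((3 : ℕ) : ℤ)).toLocal (Sum.inr v₃)) 1 →+ ZMod 3)
    (hΛker : ∀ x ∈ propagatedSelmerStructureOne W 3 (Sum.inr v₃),
      Λ x = 0 ↔ x ∈ W.kummerSelmerStructure ((3 : ℕ) : ℤ) (Sum.inr v₃))
    (h0 : Λ (galoisCohomology.localization _ (Sum.inr v₃) 1 (κ₀ ∅)) = 0) :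
    κ'.1 ∅ ∈ (W.kummerSelmerStructure ((3 : ℕ) : ℤ)).selmerGroup := by
  have heq : κ'.1 ∅ = κ₀ ∅ := kolyvaginSystem_apply_empty_eq_of_congruence κ₀ κ' hI4
  have hmem : κ'.1 ∅ ∈ (propagatedSelmerStructureOne W 3).selmerGroup :=
    ((KolyvaginDatum.mem_kolyvaginSystems_iff D _ κ'.1).mp κ'.2).apply_empty_mem
  have hmemF : galoisCohomology.localization _ (Sum.inr v₃) 1 (κ₀ ∅) ∈
      propagatedSelmerStructureOne W 3 (Sum.inr v₃) := by
    rw [← heq]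
    exact (SelmerStructure.mem_selmerGroup_iff _ _).1 hmem (Sum.inr v₃)
  have hK : galoisCohomology.localization _ (Sum.inr v₃) 1 (κ'.1 ∅) ∈
      W.kummerSelmerStructure ((3 : ℕ) : ℤ) (Sum.inr v₃) := by
    rw [heq]
    exact (hΛker _ hmemF).1 h0
  exact mem_selmerGroup_kummer_of_mem_propagated_of_localization_mem W hEP hmem v₃ hv₃ hK

/-- **At `t ≥ 1` the bottom class of the level-one Kato-type data IS a `3`-Selmer class.**  With the
VALUE CLAUSE `Λ(loc_{v₃} κ₀ ∅) = u·3^t·δ` and `1 ≤ t`: `3^t = 0` in `ℤ/3`, so the value vanishes and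
`apply_empty_mem_selmerGroup_kummer_of_apply_eq_zero` applies — for EVERY `δ`, unit or not.  So the
certificate `κ'_∅ ∉ Sel₃` consumed by p265535 CANNOT come from the dictionary when `E(ℚ₃)[3] ≠ 0`:
the EXOTIC ∧ `t = 1` corner (388800ha1, 388800ij1 — Kodaira IV*, `c₃ = 3`) is intrinsic to the
level-one method (and levels `≥ 2` are void on EXOTIC rows, p267959 / `ExoticNoHigherLevelTau`).
Refuted FOR THE METHOD, not as a statement about BSD.  Nothing booked.
[cite: Kim2022StructureSelmer, Thm. 3.13 and §3.4.1] -/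
theorem apply_empty_mem_selmerGroup_kummer_of_dictionary_of_pos
    (hEP : ∀ v : HeightOneSpectrum (𝓞 ℚ), localEulerPoincareCharacteristic (v.adicCompletion ℚ))
    {D : KolyvaginDatum (W.torsionGaloisModule ((3 : ℕ) : ℤ))}
    (v₃ : HeightOneSpectrum (𝓞 ℚ)) (hv₃ : ((3 : ℕ) : 𝓞 ℚ) ∈ v₃.asIdeal)
    (κ₀ : Finset (HeightOneSpectrum (𝓞 ℚ)) → galoisCohomology (W.torsionGaloisModule ((3 : ℕ) : ℤ)) 1)
    (κ' : D.kolyvaginSystems (propagatedSelmerStructureOne W 3))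
    (hI4 : ∀ d, D.IsLevel d →
      κ'.1 d - κ₀ d ∈ AddSubgroup.closure {x | ∃ c, c ⊂ d ∧ x = κ₀ c})
    (Λ : galoisCohomology ((W.torsionGaloisModule ((3 : ℕ) : ℤ)).toLocal (Sum.inr v₃)) 1 →+ ZMod 3)
    (hΛker : ∀ x ∈ propagatedSelmerStructureOne W 3 (Sum.inr v₃),
      Λ x = 0 ↔ x ∈ W.kummerSelmerStructure ((3 : ℕ) : ℤ) (Sum.inr v₃))
    {u : (ZMod 3)ˣ} {t : ℕ} {δ : ZMod 3}
    (hval : Λ (galoisCohomology.localization _ (Sum.inr v₃) 1 (κ₀ ∅)) =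
      (u : ZMod 3) * (3 : ZMod 3) ^ t * δ)
    (ht : 1 ≤ t) :
    κ'.1 ∅ ∈ (W.kummerSelmerStructure ((3 : ℕ) : ℤ)).selmerGroup := by
  refine apply_empty_mem_selmerGroup_kummer_of_apply_eq_zero W hEP v₃ hv₃ κ₀ κ' hI4 Λ hΛker ?_
  obtain ⟨s, rfl⟩ := Nat.exists_eq_add_of_le ht
  rw [hval, pow_add, pow_one, show (3 : ZMod 3) = 0 from rfl]
  ring

/-- **A non-unit `L`-value makes the bottom class a `3`-Selmer class too.**  With the VALUE CLAUSE
`Λ(loc_{v₃} κ₀ ∅) = u·3^t·δ` and `δ = 0` (at `d = ∅`, `δ = δ̃_1 = [0]⁺ = L(E,1)/Ω⁺_f` reduced mod `3`: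
the rows where `3 ∣ L(E,1)/Ω`, e.g. the two EXOTIC r0 rows 388800ho1, 388800ii1 with a Tamagawa
number `c_ℓ = 3` at `ℓ ≠ 3`): `κ'_∅ ∈ Sel^(3)(E/ℚ)` for every `t`.  On such rows BSD(E,3) needs a
depth `≥ 1` certificate (route R1-23), which on EXOTIC rows does not exist (no (H.2)-`τ` above level
`3`, `ExoticNoHigherLevelTau`).  Nothing booked. [cite: Kim2022StructureSelmer, Thm. 3.13 and §3.4.1] -/
theorem apply_empty_mem_selmerGroup_kummer_of_dictionary_of_delta_eq_zero
    (hEP : ∀ v : HeightOneSpectrum (𝓞 ℚ), localEulerPoincareCharacteristic (v.adicCompletion ℚ))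
    {D : KolyvaginDatum (W.torsionGaloisModule ((3 : ℕ) : ℤ))}
    (v₃ : HeightOneSpectrum (𝓞 ℚ)) (hv₃ : ((3 : ℕ) : 𝓞 ℚ) ∈ v₃.asIdeal)
    (κ₀ : Finset (HeightOneSpectrum (𝓞 ℚ)) → galoisCohomology (W.torsionGaloisModule ((3 : ℕ) : ℤ)) 1)
    (κ' : D.kolyvaginSystems (propagatedSelmerStructureOne W 3))
    (hI4 : ∀ d, D.IsLevel d →
      κ'.1 d - κ₀ d ∈ AddSubgroup.closure {x | ∃ c, c ⊂ d ∧ x = κ₀ c})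
    (Λ : galoisCohomology ((W.torsionGaloisModule ((3 : ℕ) : ℤ)).toLocal (Sum.inr v₃)) 1 →+ ZMod 3)
    (hΛker : ∀ x ∈ propagatedSelmerStructureOne W 3 (Sum.inr v₃),
      Λ x = 0 ↔ x ∈ W.kummerSelmerStructure ((3 : ℕ) : ℤ) (Sum.inr v₃))
    {u : (ZMod 3)ˣ} {t : ℕ} {δ : ZMod 3}
    (hval : Λ (galoisCohomology.localization _ (Sum.inr v₃) 1 (κ₀ ∅)) =
      (u : ZMod 3) * (3 : ZMod 3) ^ t * δ)
    (hδ : δ = 0) :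
    κ'.1 ∅ ∈ (W.kummerSelmerStructure ((3 : ℕ) : ℤ)).selmerGroup := by
  refine apply_empty_mem_selmerGroup_kummer_of_apply_eq_zero W hEP v₃ hv₃ κ₀ κ' hI4 Λ hΛker ?_
  rw [hval, hδ, mul_zero]

/-- **DICT3₁ at `t ≥ 1` certifies nothing: its Kolyvagin system has a `3`-SELMER bottom class.**  On
an additive `3 ∤ c₃`, surj(3) row of a globally minimal `W/ℚ` with `#E(ℚ₃)[3] = 3^t`, `t ≥ 1`, a place
`v₃ ∣ 3`, a Kolyvagin datum `D` on `E[3]`, Tate's `hEP`, and a modular parametrisation `P` with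
`3 ∤ c_P` and the unit period transfer: the PORT `KatoKuriharaDictionaryThreeOneAt W t D v₃` (p271070)
produces `κ' ∈ KS₁(E[3], 𝓕̄_can, 𝒫)` with `κ'_∅ ∈ Sel^(3)(E/ℚ)` — whatever the `L`-value `[0]⁺`.
Contrast p271070 `bsdp_three_of_dictionaryOne` (`t = 0`, `[0]⁺` a unit ⟹ `κ'_∅ ∉ Sel₃` ⟹ BSD(E,3)).
This is the kernel form of the cell's named corner "EXOTIC ∧ `t = 1`" ({388800ha1, 388800ij1} on
`N < 5·10⁵`): unreachable by the level-one line for a structural reason, and by higher levels because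
(H.2) fails there (p267959).  Nothing booked; no mark / label changed.
[cite: Kim2022StructureSelmer, Thm. 3.13 and §3.4.1] -/
theorem exists_kolyvaginSystem_apply_empty_mem_selmerGroup_of_dictionaryOne_of_pos
    [W.IsGloballyMinimal]
    (hEP : ∀ v : HeightOneSpectrum (𝓞 ℚ), localEulerPoincareCharacteristic (v.adicCompletion ℚ))
    (hX : Addv W 3) (hc3 : ¬ 3 ∣ (W.baseChange ℚ_[3]).localTamagawaNumber ℤ_[3])
    (h3 : W.HasSurjectiveModNGaloisRep ((3 : ℕ) : ℤ))
    {t : ℕ} (ht : 1 ≤ t)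
    (hcard : Nat.card {Q : (W.baseChange ℚ_[3]).toAffine.Point // (3 : ℕ) • Q = 0} = 3 ^ t)
    (D : KolyvaginDatum (W.torsionGaloisModule ((3 : ℕ) : ℤ)))
    (v₃ : HeightOneSpectrum (𝓞 ℚ)) (hv₃ : ((3 : ℕ) : 𝓞 ℚ) ∈ v₃.asIdeal)
    (hDict : KatoKuriharaDictionaryThreeOneAt W t D v₃)
    {N : ℕ} [NeZero N] (P : ModularParametrizationData W N)
    (hManin : ¬ ((3 : ℕ) : ℤ) ∣ P.maninConstant)
    (hΩ : ∃ u : ℚ, ‖(u : ℚ_[3])‖ = 1 ∧ W.realPeriodRat = u * plusPeriod P.f) :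
    ∃ κ' : D.kolyvaginSystems (propagatedSelmerStructureOne W 3),
      κ'.1 ∅ ∈ (W.kummerSelmerStructure ((3 : ℕ) : ℤ)).selmerGroup := by
  obtain ⟨κ₀, Λ, -, ⟨κ', hI4⟩, -, hΛker, hdict⟩ := hDict hX hc3 h3 hcard hv₃ P hManin hΩ
  obtain ⟨u, ψ, -, hval⟩ := hdict ∅ D.isLevel_empty
  exact ⟨κ', apply_empty_mem_selmerGroup_kummer_of_dictionary_of_pos W hEP v₃ hv₃ κ₀ κ' hI4 Λ hΛker
    hval ht⟩

/-- **DICT3₁ with `3 ∣ [0]⁺` certifies nothing either.**  Same as the previous theorem with, in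
place of `t ≥ 1`, the reduction of `[0]⁺_f = L(E,1)/Ω⁺_f` mod `3` equal to ZERO
(`ratModP 3 (ratPlusSymbol P.f 0) = 0`): the PORT `KatoKuriharaDictionaryThreeOneAt W t D v₃` produces
`κ' ∈ KS₁(E[3], 𝓕̄_can, 𝒫)` with `κ'_∅ ∈ Sel^(3)(E/ℚ)`.  These are the EXOTIC r0 rows with a
Tamagawa number divisible by `3` away from `3` (388800ho1, 388800ii1 on `N < 5·10⁵`): beyond the
level-one line for the method's own reason, and beyond every higher level by `ExoticNoHigherLevelTau`.
Nothing booked; no mark / label changed. [cite: Kim2022StructureSelmer, Thm. 3.13 and §3.4.1] -/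
theorem exists_kolyvaginSystem_apply_empty_mem_selmerGroup_of_dictionaryOne_of_ratModP_eq_zero
    [W.IsGloballyMinimal]
    (hEP : ∀ v : HeightOneSpectrum (𝓞 ℚ), localEulerPoincareCharacteristic (v.adicCompletion ℚ))
    (hX : Addv W 3) (hc3 : ¬ 3 ∣ (W.baseChange ℚ_[3]).localTamagawaNumber ℤ_[3])
    (h3 : W.HasSurjectiveModNGaloisRep ((3 : ℕ) : ℤ))
    {t : ℕ} (hcard : Nat.card {Q : (W.baseChange ℚ_[3]).toAffine.Point // (3 : ℕ) • Q = 0} = 3 ^ t)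
    (D : KolyvaginDatum (W.torsionGaloisModule ((3 : ℕ) : ℤ)))
    (v₃ : HeightOneSpectrum (𝓞 ℚ)) (hv₃ : ((3 : ℕ) : 𝓞 ℚ) ∈ v₃.asIdeal)
    (hDict : KatoKuriharaDictionaryThreeOneAt W t D v₃)
    {N : ℕ} [NeZero N] (P : ModularParametrizationData W N)
    (hManin : ¬ ((3 : ℕ) : ℤ) ∣ P.maninConstant)
    (hΩ : ∃ u : ℚ, ‖(u : ℚ_[3])‖ = 1 ∧ W.realPeriodRat = u * plusPeriod P.f)
    (hzero : ratModP 3 (ratPlusSymbol P.f 0) = 0) :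
    ∃ κ' : D.kolyvaginSystems (propagatedSelmerStructureOne W 3),
      κ'.1 ∅ ∈ (W.kummerSelmerStructure ((3 : ℕ) : ℤ)).selmerGroup := by
  obtain ⟨κ₀, Λ, -, ⟨κ', hI4⟩, -, hΛker, hdict⟩ := hDict hX hc3 h3 hcard hv₃ P hManin hΩ
  obtain ⟨u, ψ, -, hval⟩ := hdict ∅ D.isLevel_empty
  rw [kuriharaNumber_eq_ratModP_of_eq_one P.f 3 _ _ Finset.prod_empty ψ] at hval
  exact ⟨κ', apply_empty_mem_selmerGroup_kummer_of_dictionary_of_delta_eq_zero W hEP v₃ hv₃ κ₀ κ' hI4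
    Λ hΛker hval hzero⟩

end Summit.BirchSwinnertonDyer.Rank1Residual.GaloisImage

end
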